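import Summits.ValiantsHypothesis.ValiantsHypothesis.Theses.PermanentalCones

/-!
# `EasyRefutesHard` — uniform polynomial-size shadows kill the H+ branch

Route `route-ValiantsHypothesis-PermanentalCones`, item `stmt-ValiantsHypothesis-8656` (support,
kill chain).

`PermanentalConesEasy` gives one exponent `c₀` such that, for every `n`, `r` and every entrywise
nonnegative `Y`, the closed hyperbolicity cone of the permanental polynomial
`Q_{n,r,Y} = per[Y_{rows<r}; s^{(n−r)}]` is a spectrahedral shadow of size `m ≤ n ^ c₀ + c₀`.
`PermanentalConeHard` posits witnesses `r`, `Y` such that for EVERY `c` some `n` admits no shadow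
of size `≤ 2 ^ ((log₂ n + c) ^ c)`.  The two shadow predicates are syntactically identical, so
the implication `PermanentalConesEasy → ¬ PermanentalConeHard` reduces to the arithmetic
`n ^ c₀ + c₀ ≤ 2 ^ ((Nat.log 2 n + (c₀ + 2)) ^ (c₀ + 2))` (instantiate H+ at `c := c₀ + 2`).

Source for the kill chain: the route thesis (Saunderson–Parrilo, arXiv:1208.1443, is the model of
the uniform polynomial bound; nothing from it is needed formally here).
-/

-- `Summit.<Summit>.<Problem>` repeats `ValiantsHypothesis` by the tree's layout convention (D-0017).
set_option linter.dupNamespace false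

namespace Summit.ValiantsHypothesis.ValiantsHypothesis.Theorems

open Summit.ValiantsHypothesis.ValiantsHypothesis.Theses.PermanentalCones

/-- Polynomial versus quasi-polynomial: for every exponent `c₀` and every `n`,
`n ^ c₀ + c₀ ≤ 2 ^ ((Nat.log 2 n + (c₀ + 2)) ^ (c₀ + 2))`.  (Uses `n < 2 ^ (log₂ n + 1)`,
`c₀ < 2 ^ c₀`, and `(log₂ n + 1) * c₀ + 1 ≤ (log₂ n + c₀ + 2) ^ 2 ≤ (log₂ n + c₀ + 2) ^ (c₀ + 2)`;
also correct in the junk cases `n = 0, 1`, where `Nat.log 2 n = 0`.) -/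
theorem pow_add_self_le_two_pow_log_add_pow (c₀ n : ℕ) :
    n ^ c₀ + c₀ ≤ 2 ^ ((Nat.log 2 n + (c₀ + 2)) ^ (c₀ + 2)) := by
  set L := Nat.log 2 n with hL
  have h1 : n < 2 ^ (L + 1) := Nat.lt_pow_succ_log_self one_lt_two n
  have h2 : n ^ c₀ ≤ 2 ^ ((L + 1) * c₀) := by
    rw [pow_mul]
    exact Nat.pow_le_pow_left h1.le c₀
  have h3 : c₀ < 2 ^ c₀ := Nat.lt_two_pow_self
  have h4 : 2 ^ c₀ ≤ 2 ^ ((L + 1) * c₀) :=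
    Nat.pow_le_pow_right two_pos (by nlinarith)
  have h5 : n ^ c₀ + c₀ ≤ 2 ^ ((L + 1) * c₀ + 1) := by
    rw [pow_succ]
    omega
  have h6 : (L + 1) * c₀ + 1 ≤ (L + (c₀ + 2)) ^ (c₀ + 2) :=
    calc (L + 1) * c₀ + 1 ≤ (L + (c₀ + 2)) * (L + (c₀ + 2)) := by nlinarith
      _ = (L + (c₀ + 2)) ^ 2 := (sq _).symm
      _ ≤ (L + (c₀ + 2)) ^ (c₀ + 2) := Nat.pow_le_pow_right (by omega) (by omega)
  exact h5.trans (Nat.pow_le_pow_right two_pos h6)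

/-- Item `EasyRefutesHard` of route `PermanentalCones`:
`PermanentalConesEasy → ¬ PermanentalConeHard`.  Given the uniform exponent `c₀` of
`PermanentalConesEasy`, instantiate the H+ witnesses' "no quasi-polynomial shadow" clause at
`c := c₀ + 2`; the resulting `n` has, by `PermanentalConesEasy` applied to `(n, r n, Y n)`, a
shadow of size `m ≤ n ^ c₀ + c₀ ≤ 2 ^ ((Nat.log 2 n + (c₀ + 2)) ^ (c₀ + 2))` describing exactly
the closed cone `{x | ∀ τ > 0, Q_n(x + τ𝟙) ≠ 0}` — the description H+ says does not exist. -/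
theorem easyRefutesHard_proof :
    Summit.ValiantsHypothesis.ValiantsHypothesis.Theses.PermanentalCones.EasyRefutesHard := by
  unfold EasyRefutesHard PermanentalConesEasy PermanentalConeHard
  rintro ⟨c₀, hEasy⟩ ⟨r, Y, hY, hH⟩
  obtain ⟨_, hnone⟩ := hH (fun n => (Matrix.of fun i j : Fin n =>
    if (i : ℕ) < r n then MvPolynomial.C (Y n i j) else MvPolynomial.X j).permanent) (fun _ => rfl)
  obtain ⟨n, hn⟩ := hnone (c₀ + 2)
  obtain ⟨m, hm, p, A, B, hrep⟩ := hEasy n (r n) (Y n) (hY n) _ rfl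
  exact hn m (hm.trans (pow_add_self_le_two_pow_log_add_pow c₀ n)) p A B hrep

end Summit.ValiantsHypothesis.ValiantsHypothesis.Theorems
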